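import Summits.NavierStokesRegularity.FluidComputer.ShellBlockLyapunovForm
import Summits.NavierStokesRegularity.FluidComputer.LyapunovEigenvalueExclusion
import Summits.NavierStokesRegularity.FluidComputer.LyapunovSkewCutSemigroup

/-!
# What a 3-L (D2-type) certificate proves, composed by name (cap g6, cell `ns-blowup`, 2026-08-26)

HONEST FRAMING (human ruling D-0035): nothing here is a claim about Navier–Stokes blow-up.
WHAT THIS IS NOT: not NS evidence. This file COMPOSES the kernel pieces of the D2 certificate chain
(`HOME/cap/D2-CHAIN-MAP.md`) into the two sentences a referee reads off a `d2_cert.py` VERDICT line,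
for an abstract inner-product space `E` split into interior head `Ki` / last head shell `Kk` / first
tail shell `Ks` / deep tail `Kd` by maps `Pi Pk Ps Pd` with `Pi w + Pk w + Ps w + Pd w = w`, a
block-diagonal weight `G w = Gᵢ (Pi w) + W (Pk w) + τ (Ps w + Pd w)` and a nearest-shell-local
generator `A`:

* `generator_form_le_of_certificate` — the three certified inequalities (HEAD on `Ki ⊕ Kk` = the
  positive-pivot recursion `N′ ≽ 0`, CROSS bound `b` between shells `K`/`K+1`, TAIL levels `ηₜ` on
  `Ks ⊕ Kd`) with the non-strict pivot `b² ≤ 4 ηₕ (τ ηₜ)` give HYPOTHESIS (L)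
  `Re⟪G w, A w⟫ ≤ ω · Re⟪G w, w⟫` for EVERY `w` (`ShellBlockLyapunovForm.re_inner_weight_generator_le`
  at the pieces of `w`).
* `re_eigenvalue_le_of_certificate` — with the certified weight bounds `m‖x‖² ≤ Re⟪G x, x⟫`, `m > 0`
  (S2) and `G` symmetric: every eigenpair `A v = λ • v`, `v ≠ 0`, has `Re λ ≤ ω`
  (`LyapunovEigenvalueExclusion`), WITHOUT any semigroup-generation clause — the EXCLUSION reading
  of a certificate at `ω < 0`.
* `norm_le_of_certificate` — with `m‖x‖² ≤ Re⟪G x, x⟫ ≤ M‖x‖²`: every classical trajectory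
  `u' = A u` on `[0, T]` obeys `‖u t‖ ≤ √(M/m) · e^{ωt} · ‖u 0‖`
  (`LyapunovSkewCutSemigroup.norm_le_of_generator_form`, instab g11) — the semigroup reading
  `M_ω ≤ M_G`, modulo the generation clause S9 that supplies the trajectories.

No new definitions; std axioms.
-/

noncomputable section

namespace Summit.NavierStokesRegularity.FluidComputer.ShellBlockLyapunovCertificate

open RCLike Set
open scoped InnerProductSpace

open Summit.NavierStokesRegularity.FluidComputer.ShellBlockLyapunovForm
open Summit.NavierStokesRegularity.FluidComputer.LyapunovEigenvalueExclusion
open Summit.NavierStokesRegularity.FluidComputer.LyapunovSkewCutSemigroup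

variable {𝕜 E : Type*} [RCLike 𝕜] [NormedAddCommGroup E] [InnerProductSpace 𝕜 E]

/-- **HYPOTHESIS (L) for every `w`, from the three certified pieces.** Setting: four submodules with
the head pieces orthogonal to the tail pieces and `Ks ⟂ Kd`; decomposition maps `Pi Pk Ps Pd` into
them with `Pi w + Pk w + Ps w + Pd w = w`; block-diagonal weight pieces `Gᵢ Ki ⊆ Ki`, `W Kk ⊆ Kk`,
tail weight `τ ≥ 0`; nearest-shell locality of `A`. Certified: HEAD
`Re⟪Gᵢ i + W k, A (i + k)⟫ − ω Re⟪Gᵢ i + W k, i + k⟫ ≤ −ηₕ‖k‖²` on `Ki × Kk`; CROSS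
`|Re⟪W k, A s⟫ + τ Re⟪s, A k⟫| ≤ b‖k‖‖s‖` on `Kk × Ks`; TAIL
`Re⟪s + d, A (s + d)⟫ − ω‖s + d‖² ≤ −ηₜ‖s + d‖²` on `Ks × Kd`; `0 ≤ ηₕ`, `0 ≤ ηₜ`,
`b² ≤ 4 ηₕ (τ ηₜ)`. Conclusion: `Re⟪G w, A w⟫ ≤ ω · Re⟪G w, w⟫` for all `w`, where
`G w = Gᵢ (Pi w) + W (Pk w) + τ (Ps w + Pd w)`. -/
theorem generator_form_le_of_certificate
    {Ki Kk Ks Kd : Submodule 𝕜 E}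
    (h_is : Ki ⟂ Ks) (h_id : Ki ⟂ Kd) (h_ks : Kk ⟂ Ks) (h_kd : Kk ⟂ Kd) (h_sd : Ks ⟂ Kd)
    {Pi Pk Ps Pd : E → E} (hPi : ∀ w, Pi w ∈ Ki) (hPk : ∀ w, Pk w ∈ Kk) (hPs : ∀ w, Ps w ∈ Ks)
    (hPd : ∀ w, Pd w ∈ Kd) (hsum : ∀ w, Pi w + Pk w + Ps w + Pd w = w)
    {A Gi W : E →ₗ[𝕜] E} (hGi : ∀ x ∈ Ki, Gi x ∈ Ki) (hW : ∀ x ∈ Kk, W x ∈ Kk)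
    (hA_id : ∀ x ∈ Ki, ∀ y ∈ Kd, ⟪x, A y⟫_𝕜 = 0) (hA_di : ∀ x ∈ Kd, ∀ y ∈ Ki, ⟪x, A y⟫_𝕜 = 0)
    (hA_kd : ∀ x ∈ Kk, ∀ y ∈ Kd, ⟪x, A y⟫_𝕜 = 0) (hA_dk : ∀ x ∈ Kd, ∀ y ∈ Kk, ⟪x, A y⟫_𝕜 = 0)
    (hA_is : ∀ x ∈ Ki, ∀ y ∈ Ks, ⟪x, A y⟫_𝕜 = 0) (hA_si : ∀ x ∈ Ks, ∀ y ∈ Ki, ⟪x, A y⟫_𝕜 = 0)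
    {τ ω ηh ηt b : ℝ} (hτ : 0 ≤ τ) (hηh : 0 ≤ ηh) (hηt : 0 ≤ ηt) (hpiv : b ^ 2 ≤ 4 * ηh * (τ * ηt))
    (hHead : ∀ i ∈ Ki, ∀ k ∈ Kk,
      re ⟪Gi i + W k, A (i + k)⟫_𝕜 - ω * re ⟪Gi i + W k, i + k⟫_𝕜 ≤ -ηh * ‖k‖ ^ 2)
    (hCross : ∀ k ∈ Kk, ∀ s ∈ Ks, |re ⟪W k, A s⟫_𝕜 + τ * re ⟪s, A k⟫_𝕜| ≤ b * ‖k‖ * ‖s‖)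
    (hTail : ∀ s ∈ Ks, ∀ d ∈ Kd,
      re ⟪s + d, A (s + d)⟫_𝕜 - ω * ‖s + d‖ ^ 2 ≤ -ηt * ‖s + d‖ ^ 2)
    {G : E → E} (hGdef : ∀ w, G w = Gi (Pi w) + W (Pk w) + ((τ : 𝕜) • (Ps w + Pd w))) (w : E) :
    re ⟪G w, A w⟫_𝕜 ≤ ω * re ⟪G w, w⟫_𝕜 := by
  have key := re_inner_weight_generator_le h_is h_id h_ks h_kd h_sd hGi hW hA_id hA_di hA_kd hA_dk
    hA_is hA_si hτ hηh hηt hpiv (hPi w) (hPk w) (hPs w) (hPd w)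
    (hHead _ (hPi w) _ (hPk w)) (hCross _ (hPk w) _ (hPs w)) (hTail _ (hPs w) _ (hPd w))
  have hw : A w = A (Pi w + Pk w + Ps w + Pd w) := by rw [hsum w]
  have hw' : (ω : ℝ) * re ⟪G w, w⟫_𝕜 = ω * re ⟪G w, Pi w + Pk w + Ps w + Pd w⟫_𝕜 := by rw [hsum w]
  rw [hw, hw', hGdef w]
  exact key

/-- **The EXCLUSION reading of a certificate.** Under the hypotheses of
`generator_form_le_of_certificate`, if moreover the weight is symmetric (`⟪G x, y⟫ = ⟪x, G y⟫`) and
bounded below (`m‖x‖² ≤ Re⟪G x, x⟫`, `m > 0` — the certified `(L3)` line), then every eigenpair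
`A v = λ • v` with `v ≠ 0` has `Re λ ≤ ω`. For a certificate at `ω < 0` this says: the section has
NO eigenvalue with `Re λ > ω` (in particular none with `Re λ ≥ 0`). No semigroup clause is used. -/
theorem re_eigenvalue_le_of_certificate
    {G : E → E} (hGsym : ∀ x y : E, ⟪G x, y⟫_𝕜 = ⟪x, G y⟫_𝕜) {m ω : ℝ} (hm0 : 0 < m)
    (hm : ∀ x : E, m * ‖x‖ ^ 2 ≤ re ⟪G x, x⟫_𝕜) {A : E →ₗ[𝕜] E}
    (hL : ∀ w : E, re ⟪G w, A w⟫_𝕜 ≤ ω * re ⟪G w, w⟫_𝕜)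
    {v : E} {lam : 𝕜} (hv0 : v ≠ 0) (hv : A v = lam • v) : re lam ≤ ω :=
  re_eigenvalue_le_of_generator_form_on (D := Set.univ) (A := fun x => A x) hGsym hm0 hm
    (fun w _ => hL w) (Set.mem_univ v) hv0 hv

section Trajectories

variable [NormedSpace ℝ E]

/-- **The SEMIGROUP reading of a certificate (`M_ω ≤ M_G = √(M/m)`).** Under the hypotheses of
`generator_form_le_of_certificate`, if the weight is a symmetric bounded real-linear map with
`m‖x‖² ≤ Re⟪G x, x⟫ ≤ M‖x‖²`, `m > 0` (the certified `(L3)` line), then every classical trajectory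
`u` of `u' = A u` on `[0, T]` obeys `‖u t‖ ≤ √(M/m) · e^{ωt} · ‖u 0‖` — by
`LyapunovSkewCutSemigroup.norm_le_of_generator_form`; the existence of such trajectories for a dense
set of data is the generation clause S9, outside this file. -/
theorem norm_le_of_certificate
    {G : E →L[ℝ] E} (hGsym : ∀ x y : E, ⟪G x, y⟫_𝕜 = ⟪x, G y⟫_𝕜) {m M ω T : ℝ} (hm0 : 0 < m)
    (hm : ∀ x : E, m * ‖x‖ ^ 2 ≤ re ⟪G x, x⟫_𝕜) (hM : ∀ x : E, re ⟪G x, x⟫_𝕜 ≤ M * ‖x‖ ^ 2)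
    {A : E →ₗ[𝕜] E} (hL : ∀ w : E, re ⟪G w, A w⟫_𝕜 ≤ ω * re ⟪G w, w⟫_𝕜)
    {u : ℝ → E} (hu : ∀ t ∈ Icc 0 T, HasDerivWithinAt u (A (u t)) (Icc 0 T) t) :
    ∀ t ∈ Icc 0 T, ‖u t‖ ≤ Real.sqrt (M / m) * Real.exp (ω * t) * ‖u 0‖ :=
  norm_le_of_generator_form hGsym hm0 hm hM (D := Set.univ) (A := fun x => A x)
    (fun w _ => hL w) hu (fun _ _ => Set.mem_univ _)

end Trajectories

end Summit.NavierStokesRegularity.FluidComputer.ShellBlockLyapunovCertificate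

end
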